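import Mathlib
import Summits.KontsevichZagierPeriods.Zeta5Search.SecondOrderCentre
import HarnessLib

/-!
# ζ(5) search — the `𝒦`-digit functional `ĉ` of a level class with cofactor data `(η − c)Φ_T`, and of the ODD-CENTRE class (DENOM-LAW D1, prover-d1 gen 15)

HONEST FRAMING: systematic search; no irrationality claim unless certified.  Cell `pub-zeta5`, track «DENOM-LAW» D1, seat `denom-prover-d1`
gen 15 (`denom-law/prover-d1/ATTEMPT-15.md` §5).  Tools for the CENTRE-COMPANION IDENTITY (statement file `DenomLaw/CentreCompanion.lean`):
the exact analogues, for gen-2 g9's `𝒦`-digit type invariant `ĉ_x = cHat` (`UniversalDigit.lean` §1), of typer g11's `wHat_of_rho_mul` /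
`vHat_of_rho_mul` / `wHat_centre_level` / `vHat_centre_level` (`SecondOrderCentre.lean`):
* `typeC L e`  — `ĉ(T) := Σ_{poles i} (i² ρ^T_{i,1} + [n_i ≥ 2] 2i ρ^T_{i,2})`, the type form of `cHat` (cf. `LevelClass.typeW`, `typeV`);
* `typeC2 L e` — `ĉ₂(T) := Σ_{poles i} (i³ ρ^T_{i,1} + [n_i ≥ 2] 3i² ρ^T_{i,2} + [n_i ≥ 3] 2i ρ^T_{i,3})`, the `ĉ`-functional of `ηΦ_T`;
* `cHat_of_rho_mul` — if the cofactor data of a level class are `ρ_{i,σ} = (i − c)ρ^T_{i,σ} + ρ^T_{i,σ+1}` then `ĉ = ĉ₂(T) − c·ĉ(T)`;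
* `cHat_centre_level` — the odd-centre class of type `T = (L, e)` has `ĉ = ĉ₂(T) − (L/2)·ĉ(T)` (`classRho_centre_level`).
Pure power-series / finite-sum algebra over `ℚ`; nothing here bears on irrationality, no γ, nothing about ζ(5); records in print UNMOVED.
-/

noncomputable section

open Finset PowerSeries

namespace Summit.KontsevichZagierPeriods.Zeta5Search.SecondOrder

open Summit.KontsevichZagierPeriods.Zeta5Search.DualSeries (InBox)
open Summit.KontsevichZagierPeriods.Zeta5Search.CasoratianValuation (InPolytope)
open Summit.KontsevichZagierPeriods.Zeta5Search.ClusterValuation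
open Summit.KontsevichZagierPeriods.Zeta5Search.LevelClass (typeRho classSet_level level_injective level_mem classPoles_level)

variable {p : ℕ} [hp : Fact p.Prime]

/-! ## §1 The type forms of the `𝒦`-digit functional -/

/-- `ĉ(T) := Σ_{poles i} (i² ρ^T_{i,1} + [n_i ≥ 2] 2i ρ^T_{i,2})` — the type form of `ClusterValuation.cHat`. -/
def typeC (L : ℕ) (e : ℕ → ℤ) : ℚ :=
  ∑ i ∈ (range (L + 1)).filter (fun i => e i < 0),
    ((((i : ℕ) : ℚ)) ^ 2 * typeRho L e i 1 + (if e i ≤ -2 then 2 * ((i : ℕ) : ℚ) * typeRho L e i 2 else 0))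

/-- `ĉ₂(T) := Σ_{poles i} (i³ ρ^T_{i,1} + [n_i ≥ 2] 3i² ρ^T_{i,2} + [n_i ≥ 3] 2i ρ^T_{i,3})` — the `ĉ`-functional of `ηΦ_T`
(substitute `ρ[ηΦ_T]_{i,σ} = iρ^T_{i,σ} + ρ^T_{i,σ+1}` into `ĉ`). -/
def typeC2 (L : ℕ) (e : ℕ → ℤ) : ℚ :=
  ∑ i ∈ (range (L + 1)).filter (fun i => e i < 0),
    ((((i : ℕ) : ℚ)) ^ 3 * typeRho L e i 1 + (if e i ≤ -2 then 3 * (((i : ℕ) : ℚ)) ^ 2 * typeRho L e i 2 else 0)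
      + (if e i ≤ -3 then 2 * ((i : ℕ) : ℚ) * typeRho L e i 3 else 0))

/-! ## §2 `ĉ` of a level class with cofactor data `(η − c)Φ_T` -/

section RhoMul

variable (b : ℕ → ℤ) {x L : ℕ} (hx : x < p) (hL : x + L * p ≤ (b 0).toNat) (hL' : (b 0).toNat < x + L * p + p)
  (e : ℕ → ℤ) (he : ∀ k ≤ L, netExp b (x + k * p) = e k) (c : ℚ)
  (hrho : ∀ i ≤ L, e i < 0 → ∀ σ : ℕ, 1 ≤ σ → (σ : ℤ) ≤ -e i →
    classRho b p (x + i * p) σ = (((i : ℕ) : ℚ) - c) * typeRho L e i σ + (if (σ : ℤ) + 1 ≤ -e i then typeRho L e i (σ + 1) else 0))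
include hx hL hL' he hrho

/-- **`ĉ = ĉ₂(T) − c ĉ(T)`** when the cofactor data are those of `(η − c)Φ_T`. -/
theorem cHat_of_rho_mul : cHat b p x = typeC2 L e - c * typeC L e := by
  have hP : (classSet b p x).filter (fun q => netExp b q < 0) =
      ((range (L + 1)).filter fun k => e k < 0).image fun k => x + k * p := classPoles_level b hx hL hL' e he
  unfold cHat typeC typeC2 classPoles
  rw [hP, sum_image (fun a _ c _ h => level_injective hp.out.pos x h), mul_sum, ← sum_sub_distrib]
  refine sum_congr rfl fun k hk => ?_
  obtain ⟨hkr, hkneg⟩ := mem_filter.1 hk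
  have hkL : k ≤ L := by have := mem_range.1 hkr; omega
  rw [he k hkL, level_div hx, hrho k hkL hkneg 1 (by norm_num) (by push_cast; omega)]
  by_cases h2 : e k ≤ -2
  · rw [if_pos h2, if_pos h2, if_pos h2, if_pos (by push_cast; omega), hrho k hkL hkneg 2 (by norm_num) (by push_cast; omega)]
    by_cases h3 : e k ≤ -3
    · rw [if_pos (by push_cast; omega), if_pos h3]; ring
    · rw [if_neg (by push_cast; omega), if_neg h3]; ring
  · rw [if_neg h2, if_neg h2, if_neg h2, if_neg (by push_cast; omega), if_neg (by omega)]; ring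

end RhoMul

/-! ## §3 `ĉ` of the odd-centre class -/

section Centre

variable (b : ℕ → ℤ) {y L : ℕ} (hy : y < p) (hL : y + L * p ≤ (b 0).toNat) (hL' : (b 0).toNat < y + L * p + p)
  (hodd : ¬ (2 : ℤ) ∣ b 0) (hcen : CentreIn b p y)
include hy hL hL' hodd hcen

/-- **`ĉ` of the odd-centre class**: `ĉ_y = ĉ₂(T) − (L/2)ĉ(T)` (the class function is `(η − L/2)Φ_T`). -/
theorem cHat_centre_level (hb : InPolytope b) (e : ℕ → ℤ) (he : ∀ k ≤ L, netExp b (y + k * p) = e k) :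
    cHat b p y = typeC2 L e - (L : ℚ) / 2 * typeC L e :=
  cHat_of_rho_mul b hy hL hL' e he _ fun _ hi hneg σ _ hσ => classRho_centre_level b hy hL hL' hodd hcen hb e he hi hneg σ hσ

end Centre

/-! ## §4 `ĉ` of a centre-free level class is the type form (appended 2026-08-26, prover-d1 g15) -/

section Level

variable (b : ℕ → ℤ) {x L : ℕ} (hx : x < p) (hL : x + L * p ≤ (b 0).toNat) (hL' : (b 0).toNat < x + L * p + p)
include hx hL hL'

/-- **`ĉ_x = ĉ(T)`** for a centre-free level class of type `T = (L, e)` (the analogue of `LevelClass.wHat_level` / `vHat_level`; the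
companion pair `T ++ [1]`, `1 :: T` of the centre-companion identity are such classes). -/
theorem cHat_level (e : ℕ → ℤ) (he : ∀ k ≤ L, netExp b (x + k * p) = e k) (hc : ¬ CentreIn b p x) :
    cHat b p x = typeC L e := by
  have hP : (classSet b p x).filter (fun q => netExp b q < 0) =
      ((range (L + 1)).filter fun k => e k < 0).image fun k => x + k * p := classPoles_level b hx hL hL' e he
  unfold cHat typeC classPoles
  rw [hP, sum_image (fun a _ c _ h => level_injective hp.out.pos x h)]
  refine sum_congr rfl fun k hk => ?_
  have hkL : k ≤ L := by have := mem_range.1 (mem_filter.1 hk).1; omega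
  rw [he k hkL, level_div hx, LevelClass.classRho_level b hx hL hL' e he hc hkL, LevelClass.classRho_level b hx hL hL' e he hc hkL]

end Level

end Summit.KontsevichZagierPeriods.Zeta5Search.SecondOrder

end
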